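import Literature.NumberTheory.Rogawski1990.ArchCentralLimitChamberTransport
import Literature.Analysis.Calculus.VandermondeGermLetter
import Literature.Analysis.Calculus.VandermondeDivisionThree
import HarnessLib

/-!
# The 8-ray corner functional on an `S₃`-ALTERNATION: covariance under every permutation and the value `12 • h₁(0) = 6 ℓ`
# (Rogawski 1990 §8.4 p. 126; Harish-Chandra 1975 §17 Lemma 17.5)

Topic `NumberTheory/Rogawski1990`; namespace `Literature.NumberTheory.Rogawski1990`.  THEOREMS ONLY (no `def`, no instance, no notation, no axiom,
no named fact, no `sorry`).  Cell `pub/hodgecm-mathlib`, crux H413 (`stmt-HodgeConjecture-24833`), N8-INNER ROAD B brick (10)(C′) «CORNER EP PACKAGE»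
(sigsheet `SIGSHEET-N8-brick10Cprime-assembly.v1` §3 (s4)); author F0P3a-p03 (g25).  Count-neutral.

THE MATHEMATICS.  `L[H] := Σ_ε s_ε (d∕ds)³|₀ H(s·v_ε)` is the letter's polarised `ω = ∏(∂_i − ∂_j)` at the corner (base point `0` of the angle
chart).  §1: `L[H ∘ (·∘σ)] = sign σ · L[H]` for EVERY `σ ∈ S₃` (★ `sum_sign_iteratedDeriv_ray_comp_swap01∕12∕02_eq_neg` + `Equiv.Perm.swap_induction_on`;
any `H`, no smoothness).  §2: hence for the ALTERNATION `Φ := Σ_σ sign σ · H(· ∘ σ)` of a function `H` thrice differentiable at the corner rays,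
`L[Φ] = 6 · L[H]`.  §3 (the (C′) value step): if `H` is smooth, `L[H](x) → ℓ` along the regular angles `x → 0` (the ★ letter
`ArchCentralLimitFormulaRankTwo` read in the angle chart), and `Φ = Vand • h₁` near `0` with `h₁` smooth (★ germ Vandermonde division), then
**`(12 : ℂ) * h₁ 0 = 6 * ℓ`** — by ★ `VandermondeGermLetter` (`L[Vand • h₁](0) = 12 • h₁ 0`, with its `1∕48`) and continuity of `L[H]`.
So `h₁ 0 = ℓ ∕ 2 ≠ 0` whenever `ℓ ≠ 0`: the non-vanishing `h(b_ζ) ≠ 0` of the corner EP head.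
HONEST LABEL: HC_CM is proved only modulo the 7 printed citations (2 remaining: hLiu418 = `stmt-HodgeConjecture-24832`, h413 = `stmt-HodgeConjecture-24833`)
until rung 0 closes; count-neutral.

## References
* [Rogawski1990] J. D. Rogawski, *Automorphic Representations of Unitary Groups in Three Variables*, Ann. of Math. Stud. 123 (1990), §8.4 pp. 126–127.
* [HarishChandra1975HARRG1] Harish-Chandra, *Harmonic analysis on real reductive groups I*, J. Funct. Anal. 19 (1975), §17 Lemma 17.5.
-/

set_option autoImplicit false

noncomputable section

open Filter Topology Function Finset
open scoped ContDiff

namespace Literature.NumberTheory.Rogawski1990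

/-! ## §1 Covariance of the 8-ray functional under every permutation -/

section Covariance

/-- Skewness under an arbitrary transposition `swap a b`, `a ≠ b` (the three ★ cases, `swap b a = swap a b`). [cite: Rogawski1990, §8.4 p. 126] -/
theorem sum_sign_iteratedDeriv_ray_comp_swap_eq_neg (H : (Fin 3 → ℝ) → ℂ) {a b : Fin 3} (hab : a ≠ b) :
    ∑ ε : Fin 3 → Bool, ((((if ε 0 then (1 : ℝ) else -1) * (if ε 1 then (1 : ℝ) else -1) * (if ε 2 then (1 : ℝ) else -1) : ℝ)) : ℂ) * iteratedDeriv 3 (fun s : ℝ => H ((s • ![(if ε 0 then (1 : ℝ) else -1) + (if ε 1 then (1 : ℝ) else -1), -(if ε 0 then (1 : ℝ) else -1) + (if ε 2 then (1 : ℝ) else -1), -(if ε 1 then (1 : ℝ) else -1) - (if ε 2 then (1 : ℝ) else -1)]) ∘ ⇑(Equiv.swap a b))) 0 =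
      -(∑ ε : Fin 3 → Bool, ((((if ε 0 then (1 : ℝ) else -1) * (if ε 1 then (1 : ℝ) else -1) * (if ε 2 then (1 : ℝ) else -1) : ℝ)) : ℂ) * iteratedDeriv 3 (fun s : ℝ => H (s • ![(if ε 0 then (1 : ℝ) else -1) + (if ε 1 then (1 : ℝ) else -1), -(if ε 0 then (1 : ℝ) else -1) + (if ε 2 then (1 : ℝ) else -1), -(if ε 1 then (1 : ℝ) else -1) - (if ε 2 then (1 : ℝ) else -1)])) 0) := by
  fin_cases a <;> fin_cases b
  · exact absurd rfl hab
  · exact sum_sign_iteratedDeriv_ray_comp_swap01_eq_neg H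
  · exact sum_sign_iteratedDeriv_ray_comp_swap02_eq_neg H
  · rw [Equiv.swap_comm]; exact sum_sign_iteratedDeriv_ray_comp_swap01_eq_neg H
  · exact absurd rfl hab
  · exact sum_sign_iteratedDeriv_ray_comp_swap12_eq_neg H
  · rw [Equiv.swap_comm]; exact sum_sign_iteratedDeriv_ray_comp_swap02_eq_neg H
  · rw [Equiv.swap_comm]; exact sum_sign_iteratedDeriv_ray_comp_swap12_eq_neg H
  · exact absurd rfl hab

/-- **Covariance under every permutation**: `L[H ∘ (·∘σ)] = sign σ · L[H]`. [cite: Rogawski1990, §8.4 p. 126] -/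
theorem sum_sign_iteratedDeriv_ray_comp_perm_eq_sign_mul (H : (Fin 3 → ℝ) → ℂ) (σ : Equiv.Perm (Fin 3)) :
    ∑ ε : Fin 3 → Bool, ((((if ε 0 then (1 : ℝ) else -1) * (if ε 1 then (1 : ℝ) else -1) * (if ε 2 then (1 : ℝ) else -1) : ℝ)) : ℂ) * iteratedDeriv 3 (fun s : ℝ => H ((s • ![(if ε 0 then (1 : ℝ) else -1) + (if ε 1 then (1 : ℝ) else -1), -(if ε 0 then (1 : ℝ) else -1) + (if ε 2 then (1 : ℝ) else -1), -(if ε 1 then (1 : ℝ) else -1) - (if ε 2 then (1 : ℝ) else -1)]) ∘ ⇑σ)) 0 =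
      ((Equiv.Perm.sign σ : ℤ) : ℂ) * ∑ ε : Fin 3 → Bool, ((((if ε 0 then (1 : ℝ) else -1) * (if ε 1 then (1 : ℝ) else -1) * (if ε 2 then (1 : ℝ) else -1) : ℝ)) : ℂ) * iteratedDeriv 3 (fun s : ℝ => H (s • ![(if ε 0 then (1 : ℝ) else -1) + (if ε 1 then (1 : ℝ) else -1), -(if ε 0 then (1 : ℝ) else -1) + (if ε 2 then (1 : ℝ) else -1), -(if ε 1 then (1 : ℝ) else -1) - (if ε 2 then (1 : ℝ) else -1)])) 0 := by
  induction σ using Equiv.Perm.swap_induction_on generalizing H with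
  | one =>
    simp only [Equiv.Perm.coe_one, Function.comp_id, Equiv.Perm.sign_one, Units.val_one, Int.cast_one, one_mul]
  | swap_mul f a b hab ih =>
    -- `(s v) ∘ (swap * f) = ((s v) ∘ swap) ∘ f`: the swap lemma for `K y := H (y ∘ f)`, then the induction hypothesis
    have hcomp : ∀ (y : Fin 3 → ℝ), y ∘ ⇑(Equiv.swap a b * f) = (y ∘ ⇑(Equiv.swap a b)) ∘ ⇑f := by
      intro y; rfl
    simp_rw [hcomp]
    have h2 := sum_sign_iteratedDeriv_ray_comp_swap_eq_neg (fun y => H (y ∘ ⇑f)) hab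
    rw [h2, ih H, Equiv.Perm.sign_mul, Equiv.Perm.sign_swap hab]
    simp only [Units.val_mul, Units.val_neg, Units.val_one, Int.cast_mul, Int.cast_neg, Int.cast_one]
    ring

end Covariance

/-! ## §2 The functional of the alternation -/

section Alternation

/-- **`L[Σ_σ sign σ · H(·∘σ)] = 6 · L[H]`** at the corner, for `H` thrice continuously differentiable near the eight rays through `0`.
[cite: Rogawski1990, §8.4 p. 126] [cite: HarishChandra1975HARRG1, §17 Lemma 17.5] -/
theorem sum_sign_iteratedDeriv_ray_alternation (H : (Fin 3 → ℝ) → ℂ) (hH : ContDiff ℝ 3 H) :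
    ∑ ε : Fin 3 → Bool, ((((if ε 0 then (1 : ℝ) else -1) * (if ε 1 then (1 : ℝ) else -1) * (if ε 2 then (1 : ℝ) else -1) : ℝ)) : ℂ) * iteratedDeriv 3 (fun s : ℝ => ∑ σ : Equiv.Perm (Fin 3), ((Equiv.Perm.sign σ : ℤ) : ℂ) * H ((s • ![(if ε 0 then (1 : ℝ) else -1) + (if ε 1 then (1 : ℝ) else -1), -(if ε 0 then (1 : ℝ) else -1) + (if ε 2 then (1 : ℝ) else -1), -(if ε 1 then (1 : ℝ) else -1) - (if ε 2 then (1 : ℝ) else -1)]) ∘ ⇑σ)) 0 =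
      6 * ∑ ε : Fin 3 → Bool, ((((if ε 0 then (1 : ℝ) else -1) * (if ε 1 then (1 : ℝ) else -1) * (if ε 2 then (1 : ℝ) else -1) : ℝ)) : ℂ) * iteratedDeriv 3 (fun s : ℝ => H (s • ![(if ε 0 then (1 : ℝ) else -1) + (if ε 1 then (1 : ℝ) else -1), -(if ε 0 then (1 : ℝ) else -1) + (if ε 2 then (1 : ℝ) else -1), -(if ε 1 then (1 : ℝ) else -1) - (if ε 2 then (1 : ℝ) else -1)])) 0 := by
  -- linearity of the third derivative at `0`
  have hsmooth : ∀ (ε : Fin 3 → Bool) (σ : Equiv.Perm (Fin 3)),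
      ContDiff ℝ 3 (fun s : ℝ => H ((s • ![(if ε 0 then (1 : ℝ) else -1) + (if ε 1 then (1 : ℝ) else -1), -(if ε 0 then (1 : ℝ) else -1) + (if ε 2 then (1 : ℝ) else -1), -(if ε 1 then (1 : ℝ) else -1) - (if ε 2 then (1 : ℝ) else -1)]) ∘ ⇑σ)) := by
    intro ε σ
    exact hH.comp ((contDiff_pi.2 fun k => contDiff_apply ℝ ℝ (σ k)).comp (contDiff_id.smul contDiff_const))
  have hlin : ∀ ε : Fin 3 → Bool, iteratedDeriv 3 (fun s : ℝ => ∑ σ : Equiv.Perm (Fin 3), ((Equiv.Perm.sign σ : ℤ) : ℂ) * H ((s • ![(if ε 0 then (1 : ℝ) else -1) + (if ε 1 then (1 : ℝ) else -1), -(if ε 0 then (1 : ℝ) else -1) + (if ε 2 then (1 : ℝ) else -1), -(if ε 1 then (1 : ℝ) else -1) - (if ε 2 then (1 : ℝ) else -1)]) ∘ ⇑σ)) 0 =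
      ∑ σ : Equiv.Perm (Fin 3), ((Equiv.Perm.sign σ : ℤ) : ℂ) * iteratedDeriv 3 (fun s : ℝ => H ((s • ![(if ε 0 then (1 : ℝ) else -1) + (if ε 1 then (1 : ℝ) else -1), -(if ε 0 then (1 : ℝ) else -1) + (if ε 2 then (1 : ℝ) else -1), -(if ε 1 then (1 : ℝ) else -1) - (if ε 2 then (1 : ℝ) else -1)]) ∘ ⇑σ)) 0 := by
    intro ε
    rw [iteratedDeriv_fun_sum (fun σ _ => (contDiff_const.mul (hsmooth ε σ)).contDiffAt)]
    refine Finset.sum_congr rfl fun σ _ => ?_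
    exact iteratedDeriv_const_mul _ (hsmooth ε σ).contDiffAt
  have hswap : (∑ ε : Fin 3 → Bool, ((((if ε 0 then (1 : ℝ) else -1) * (if ε 1 then (1 : ℝ) else -1) * (if ε 2 then (1 : ℝ) else -1) : ℝ)) : ℂ) * ∑ σ : Equiv.Perm (Fin 3), ((Equiv.Perm.sign σ : ℤ) : ℂ) * iteratedDeriv 3 (fun s : ℝ => H ((s • ![(if ε 0 then (1 : ℝ) else -1) + (if ε 1 then (1 : ℝ) else -1), -(if ε 0 then (1 : ℝ) else -1) + (if ε 2 then (1 : ℝ) else -1), -(if ε 1 then (1 : ℝ) else -1) - (if ε 2 then (1 : ℝ) else -1)]) ∘ ⇑σ)) 0) =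
      ∑ σ : Equiv.Perm (Fin 3), ((Equiv.Perm.sign σ : ℤ) : ℂ) * ∑ ε : Fin 3 → Bool, ((((if ε 0 then (1 : ℝ) else -1) * (if ε 1 then (1 : ℝ) else -1) * (if ε 2 then (1 : ℝ) else -1) : ℝ)) : ℂ) * iteratedDeriv 3 (fun s : ℝ => H ((s • ![(if ε 0 then (1 : ℝ) else -1) + (if ε 1 then (1 : ℝ) else -1), -(if ε 0 then (1 : ℝ) else -1) + (if ε 2 then (1 : ℝ) else -1), -(if ε 1 then (1 : ℝ) else -1) - (if ε 2 then (1 : ℝ) else -1)]) ∘ ⇑σ)) 0 := by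
    simp_rw [Finset.mul_sum]
    rw [Finset.sum_comm]
    exact Finset.sum_congr rfl fun σ _ => Finset.sum_congr rfl fun ε _ => by ring
  simp_rw [hlin]
  rw [hswap]
  simp_rw [sum_sign_iteratedDeriv_ray_comp_perm_eq_sign_mul H, ← mul_assoc]
  have hsq : ∀ σ : Equiv.Perm (Fin 3), ((Equiv.Perm.sign σ : ℤ) : ℂ) * ((Equiv.Perm.sign σ : ℤ) : ℂ) = 1 := by
    intro σ
    rcases Int.units_eq_one_or (Equiv.Perm.sign σ) with h | h <;> simp [h]
  simp_rw [hsq, one_mul, Finset.sum_const, Finset.card_univ, Fintype.card_perm, Fintype.card_fin, nsmul_eq_mul]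
  norm_num [Nat.factorial]

end Alternation

/-! ## §3 The value step of the corner EP package -/

section Value

/-- **`12 · h₁(0) = 6 ℓ`**: if `H` is smooth, its 8-ray functional tends to `ℓ` along the regular angles at the corner, and the alternation of `H` is
`Vand • h₁` near `0` with `h₁` smooth, then `12 h₁(0) = 6 ℓ` (so `h₁ 0 ≠ 0` iff `ℓ ≠ 0`). [cite: Rogawski1990, §8.4 pp. 126–127]
[cite: HarishChandra1975HARRG1, §17 Lemma 17.5] -/
theorem twelve_mul_eq_six_mul_of_alternation_eq_vandermonde_smul (H : (Fin 3 → ℝ) → ℂ) (hH : ContDiff ℝ ∞ H)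
    (h₁ : (Fin 3 → ℝ) → ℂ) (hh₁ : ContDiff ℝ ∞ h₁)
    (hΦ : ∀ᶠ x in 𝓝 (0 : Fin 3 → ℝ), (∑ σ : Equiv.Perm (Fin 3), ((Equiv.Perm.sign σ : ℤ) : ℂ) * H (x ∘ ⇑σ)) =
      ((x 0 - x 1) * (x 0 - x 2) * (x 1 - x 2)) • h₁ x)
    (ℓ : ℂ) (hlim : Tendsto (fun x : Fin 3 → ℝ => (1 / 48 : ℂ) * ∑ ε : Fin 3 → Bool, ((((if ε 0 then (1 : ℝ) else -1) * (if ε 1 then (1 : ℝ) else -1) * (if ε 2 then (1 : ℝ) else -1) : ℝ)) : ℂ) *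
      iteratedDeriv 3 (fun s : ℝ => H (x + s • ![(if ε 0 then (1 : ℝ) else -1) + (if ε 1 then (1 : ℝ) else -1), -(if ε 0 then (1 : ℝ) else -1) + (if ε 2 then (1 : ℝ) else -1), -(if ε 1 then (1 : ℝ) else -1) - (if ε 2 then (1 : ℝ) else -1)])) 0) (𝓝[{x : Fin 3 → ℝ | Function.Injective x}] 0) (𝓝 ℓ)) :
    (12 : ℂ) * h₁ 0 = 6 * ℓ := by
  -- (1) continuity of `L[H]` gives `L[H](0) = 48 ℓ'`… we work with the `1∕48`-normalised functional `Λ`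
  set Λ : ((Fin 3 → ℝ) → ℂ) → (Fin 3 → ℝ) → ℂ := fun G x => (1 / 48 : ℂ) * ∑ ε : Fin 3 → Bool, ((((if ε 0 then (1 : ℝ) else -1) * (if ε 1 then (1 : ℝ) else -1) * (if ε 2 then (1 : ℝ) else -1) : ℝ)) : ℂ) *
      iteratedDeriv 3 (fun s : ℝ => G (x + s • ![(if ε 0 then (1 : ℝ) else -1) + (if ε 1 then (1 : ℝ) else -1), -(if ε 0 then (1 : ℝ) else -1) + (if ε 2 then (1 : ℝ) else -1), -(if ε 1 then (1 : ℝ) else -1) - (if ε 2 then (1 : ℝ) else -1)])) 0 with hΛ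
  -- continuity of `Λ H` (★ `VandermondeGermLetter.continuous_letterFunctional`, parameter `PUnit`)
  have hcontH : Continuous (Λ H) := by
    have h := Literature.Analysis.Calculus.continuous_letterFunctional (P := PUnit.{1}) (E := ℂ)
      (fun q : (Fin 3 → ℝ) × PUnit => H q.1) (hH.comp contDiff_fst)
    have h' := h.comp (Continuous.prodMk continuous_id (continuous_const (y := PUnit.unit)))
    refine h'.congr fun x => ?_
    simp only [hΛ, comp_apply, id_eq, Complex.real_smul]
    push_cast
    rfl
  -- the regular angles accumulate at `0`
  haveI : (𝓝[{x : Fin 3 → ℝ | Function.Injective x}] (0 : Fin 3 → ℝ)).NeBot := by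
    refine mem_closure_iff_nhdsWithin_neBot.1 ?_
    have hd := Literature.Analysis.Calculus.dense_setOf_injective (P := PUnit.{1})
    have := hd ((0 : Fin 3 → ℝ), PUnit.unit)
    rw [mem_closure_iff_nhds] at this ⊢
    intro t ht
    obtain ⟨⟨y, u⟩, hy, hyinj⟩ := this (t ×ˢ Set.univ) (prod_mem_nhds ht Filter.univ_mem)
    exact ⟨y, hy.1, hyinj⟩
  have hval : Λ H 0 = ℓ := tendsto_nhds_unique ((hcontH.tendsto 0).mono_left nhdsWithin_le_nhds) hlim
  -- (2) the alternation: `Λ Φ (0) = 6 Λ H (0)` by §2 (rays from `0 + s v = s v`)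
  set Φ : (Fin 3 → ℝ) → ℂ := fun x => ∑ σ : Equiv.Perm (Fin 3), ((Equiv.Perm.sign σ : ℤ) : ℂ) * H (x ∘ ⇑σ) with hΦdef
  have hΦs : ContDiff ℝ ∞ Φ := by
    refine ContDiff.sum fun σ _ => contDiff_const.mul (hH.comp ?_)
    exact contDiff_pi.2 fun k => contDiff_apply ℝ ℝ (σ k)
  have halt : Λ Φ 0 = 6 * Λ H 0 := by
    simp only [hΛ, hΦdef, zero_add]
    rw [sum_sign_iteratedDeriv_ray_alternation H (hH.of_le (by norm_cast))]
    ring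
  -- (3) `Λ Φ (0) = 12 h₁ 0` by ★ `tendsto_letterFunctional_of_eventuallyEq_vandermonde_smul` (parameter `PUnit`)
  have h12 : Λ Φ 0 = 12 * h₁ 0 := by
    have hT := Literature.Analysis.Calculus.tendsto_letterFunctional_of_eventuallyEq_vandermonde_smul (P := PUnit.{1}) (E := ℂ)
      (fun q : (Fin 3 → ℝ) × PUnit => Φ q.1) (hΦs.comp contDiff_fst) (fun q => h₁ q.1) (hh₁.comp contDiff_fst) 0 PUnit.unit ?_ le_rfl
    · -- the functional of `q ↦ Φ q.1` at `(x, ())` is `Λ Φ x`; continuity gives the value at `0`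
      have hc : Continuous fun q : (Fin 3 → ℝ) × PUnit => Λ Φ q.1 :=
        ((Literature.Analysis.Calculus.continuous_letterFunctional (P := PUnit.{1}) (E := ℂ)
          (fun q : (Fin 3 → ℝ) × PUnit => Φ q.1) (hΦs.comp contDiff_fst)).congr fun q => by
            simp only [hΛ, Complex.real_smul]
            push_cast; rfl)
      have hT' : Tendsto (fun q : (Fin 3 → ℝ) × PUnit => Λ Φ q.1) (𝓝 ((fun _ : Fin 3 => (0:ℝ)), PUnit.unit)) (𝓝 ((12 : ℝ) • h₁ (fun _ => (0:ℝ)))) := by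
        refine hT.congr' (Eventually.of_forall fun q => ?_)
        simp only [hΛ, Complex.real_smul]
        push_cast; rfl
      have := tendsto_nhds_unique (hc.tendsto _) hT'
      rw [Complex.real_smul] at this
      have h0 : (fun _ : Fin 3 => (0:ℝ)) = 0 := rfl
      rw [h0] at this
      exact_mod_cast this
    · have h0 : ((fun _ : Fin 3 => (0:ℝ)), PUnit.unit) = ((0 : Fin 3 → ℝ), PUnit.unit) := rfl
      rw [h0, nhds_prod_eq]
      have := hΦ.prod_inl (𝓝 PUnit.unit)
      refine this.mono fun q hq => ?_
      simp only [hΦdef] at hq ⊢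
      rw [hq, Complex.real_smul]
  rw [← h12, halt, hval]

end Value

end Literature.NumberTheory.Rogawski1990

end
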